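import Summits.QuantumFields.YangMills.Theorems.PencilRigidityWeakCouplingHypercubicLimitStubGapOfRPSpectral
import Summits.QuantumFields.YangMills.Theorems.PencilRigidityWeakCouplingHypercubicLimitOfUfbCore
import Summits.QuantumFields.YangMills.Theorems.PencilRigidityWeakCouplingHypercubicLimitSiblingTie
import Summits.QuantumFields.YangMills.Theorems.PencilRigidityWeakCouplingHypercubicLimitIRInputsOfColdPressure
import HarnessLib

/-!
# Crux `WeakCouplingHypercubicLimit` (stmt-QuantumFields-16120) from the RP CORE — the lattice-gap conjunct is redundant

Line `Sketch` of crux stmt-16120, continuation lead c6, reshape r14.  The landed closure `weakCouplingHypercubicLimit_of_ufbCore`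
(`…OfUfbCore.lean`, p139921) runs from the six-conjunct UFB core whose IR conjunct is `HasLatticeMassGap r sch Δ ∧ RPSpectral r sch Δ C`.
By `stub_gapOfRPSpectral` (`…StubGapOfRPSpectral.lean`: odd-torus reflection positivity — mirror correlators are non-negative and
step-one log-convex in the lag, the long-lag window folds onto short lags of the reversed observable) the RP-spectral clustering
ALONE gives the volume-uniform lattice gap at half the rate, and `stub_rpSpectralAnti` realigns the RP-spectral rate.  Hence:

* `weakCouplingHypercubicLimit_of_rpCore` — the crux BY NAME from the RP CORE: weak coupling ∧ `PolyVolume` ∧ `PolyRenorm` ∧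
  `UniformFunctionalBoundPlanes` ∧ (∃ Δ C, 0 < Δ ∧ RPSpectral r sch Δ C) ∧ ONE time-separated `κ₃` floor (FIVE inputs: the IR input is ONE
  clustering statement); `hypercubicLimit_of_rpCore` — the twin stmt-16154 by name (`stub_siblingTie`);
* `weakCouplingHypercubicLimit_of_ufbCoreRates` — the c5-registered variant with INDEPENDENT rates for the gap and the RP-spectral
  clustering (`hasLatticeMassGap_anti`, `stub_rpSpectralAnti`).

Refs: OsterwalderSeiler1978 §2; Seiler1982 Ch. 2; JaffeWitten2000 §5. [folklore]
-/

noncomputable section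

open scoped SchwartzMap
open MeasureTheory Filter Topology
open Literature.MathematicalPhysics.AQFT Literature.MathematicalPhysics.QuantumLattice
open Literature.MathematicalPhysics.QuantumFieldTheory
open Summit.QuantumFields.YangMills.Cruxes.HypercubicLimit.CouplingResponse

namespace Summit.QuantumFields.YangMills.Theorems.WeakCouplingHypercubicLimit.TraceNormColdPressure

/-- **The c5-registered sub-goal `weakCouplingHypercubicLimit_of_ufbCoreRates`**: the UFB core with INDEPENDENT rates for the lattice gap
and the RP-spectral clustering implies the crux (align both to `min Δ₁ Δ₂` by `hasLatticeMassGap_anti` (c4, `…IRInputsOfColdPressure`) and K1, then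
`weakCouplingHypercubicLimit_of_ufbCore`). [folklore] -/
theorem weakCouplingHypercubicLimit_of_ufbCoreRates : (∀ (G : Type) [Group G] [TopologicalSpace G] [IsTopologicalGroup G] [CompactSpace G] [MeasurableSpace G] [BorelSpace G], IsCompactSimpleLieGroup G → ∃ (r : LatticeRep G) (sch : SpeciesScheme (YMSpecies G)), sch.HasWeakCouplingLimit ∧ PolyVolume sch ∧ PolyRenorm r sch ∧ UniformFunctionalBoundPlanes r sch ∧ (∃ Δ : ℝ, 0 < Δ ∧ HasLatticeMassGap r sch Δ) ∧ (∃ Δ C : ℝ, 0 < Δ ∧ RPSpectral r sch Δ C) ∧ (∃ (f g h : 𝓢(EuclideanSpace ℝ (Fin 4), ℝ)) (δ : ℝ), tsupport f ⊆ {y : EuclideanSpace ℝ (Fin 4) | y 0 < 0} ∧ tsupport g ⊆ {y : EuclideanSpace ℝ (Fin 4) | 0 < y 0} ∧ tsupport h ⊆ {y : EuclideanSpace ℝ (Fin 4) | 0 < y 0} ∧ Disjoint (tsupport g) (tsupport h) ∧ 0 < δ ∧ ∀ᶠ k in atTop, δ ≤ |latticeSchwinger r.ρ sch (fun s => s.F)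 k 3 (fun _ => r.curvature) ![f, g, h] - latticeSchwinger r.ρ sch (fun s => s.F) k 1 (fun _ => r.curvature) ![f] * latticeSchwinger r.ρ sch (fun s => s.F) k 2 (fun _ => r.curvature) ![g, h] - latticeSchwinger r.ρ sch (fun s => s.F) k 1 (fun _ => r.curvature) ![g] * latticeSchwinger r.ρ sch (fun s => s.F) k 2 (fun _ => r.curvature) ![f, h] - latticeSchwinger r.ρ sch (fun s => s.F) k 1 (fun _ => r.curvature) ![h] * latticeSchwinger r.ρ sch (fun s => s.F) k 2 (fun _ => r.curvature) ![f, g] + 2 * (latticeSchwinger r.ρ sch (fun s => s.F) k 1 (fun _ => r.curvature) ![f] * latticeSchwinger r.ρ sch (fun s => s.F) k 1 (fun _ => r.curvature) ![g] * latticeSchwinger r.ρ sch (fun s => s.F) k 1 (fun _ => r.curvature) ![h])|)) → Summit.QuantumFields.YangMills.Theses.PencilRigidity.WeakCouplingHypercubicLimit := by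
  intro hcore
  refine weakCouplingHypercubicLimit_of_ufbCore
    fun G _ _ _ _ _ _ hG => ?_
  obtain ⟨r, sch, hw, hpv, hpr, hUFB, ⟨Δ₁, hΔ₁, hgap⟩, ⟨Δ₂, C, hΔ₂, hRP⟩, hNG⟩ := hcore G hG
  refine ⟨r, sch, hw, hpv, hpr, hUFB, ⟨min Δ₁ Δ₂, 2 * max C 0, lt_min hΔ₁ hΔ₂,
    hasLatticeMassGap_anti r sch hgap (min_le_left _ _),
    stub_rpSpectralAnti G r sch Δ₂ (min Δ₁ Δ₂) C (lt_min hΔ₁ hΔ₂).le (min_le_right _ _) hRP⟩, hNG⟩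

/-- **The gap pair from the RP-spectral clustering alone** — the first conjunct of `IRInputs r sch` (`irInputs_iff`): along a
weak-coupling scheme, `RPSpectral r sch Δ C` with `Δ > 0` gives `HasLatticeMassGap r sch (Δ/2) ∧ RPSpectral r sch (Δ/2) (2 max C 0)`.
Socket for every host that consumes `IRInputs` (a)+(b) (the coupling-response closure of stmt-16154, `peel-and-disseminate`'s
`stub_hostIRInputs`, the cold-pressure lever `irInputs_of_coldPressure`). [folklore] -/
theorem gapPair_of_rpSpectral {G : Type} [Group G] [TopologicalSpace G] [IsTopologicalGroup G] [CompactSpace G]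
    [MeasurableSpace G] [BorelSpace G] (r : LatticeRep G) (sch : SpeciesScheme (YMSpecies G))
    (hw : sch.HasWeakCouplingLimit) {Δ C : ℝ} (hΔ : 0 < Δ) (hRP : RPSpectral r sch Δ C) :
    ∃ Δ' C' : ℝ, 0 < Δ' ∧ HasLatticeMassGap r sch Δ' ∧ RPSpectral r sch Δ' C' :=
  ⟨Δ / 2, 2 * max C 0, half_pos hΔ, stub_gapOfRPSpectral G r sch Δ C hΔ (Filter.tendsto_atTop.1 hw 0) hRP,
    stub_rpSpectralAnti G r sch Δ (Δ / 2) C (by linarith) (by linarith) hRP⟩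

/-- **The crux `WeakCouplingHypercubicLimit` (stmt-16120) BY NAME from the RP CORE** (registered sub-goal of line `Sketch`, r14):
weak coupling ∧ `PolyVolume` ∧ `PolyRenorm` ∧ `UniformFunctionalBoundPlanes` ∧ (∃ Δ C, 0 < Δ ∧ `RPSpectral r sch Δ C`) ∧ ONE
time-separated `κ₃` floor ⇒ the existence-minus-rotations leg of `YangMills` in one-field gauge at weak coupling.  The lattice gap
at rate `Δ/2` is `stub_gapOfRPSpectral` (`β_k ≥ 0` eventually by the weak-coupling clause), the RP-spectral clause at rate `Δ/2` is
`stub_rpSpectralAnti`, and the rest is `weakCouplingHypercubicLimit_of_ufbCore`. [folklore] -/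
theorem weakCouplingHypercubicLimit_of_rpCore : (∀ (G : Type) [Group G] [TopologicalSpace G] [IsTopologicalGroup G] [CompactSpace G] [MeasurableSpace G] [BorelSpace G], IsCompactSimpleLieGroup G → ∃ (r : LatticeRep G) (sch : SpeciesScheme (YMSpecies G)), sch.HasWeakCouplingLimit ∧ PolyVolume sch ∧ PolyRenorm r sch ∧ UniformFunctionalBoundPlanes r sch ∧ (∃ Δ C : ℝ, 0 < Δ ∧ RPSpectral r sch Δ C) ∧ (∃ (f g h : 𝓢(EuclideanSpace ℝ (Fin 4), ℝ)) (δ : ℝ), tsupport f ⊆ {y : EuclideanSpace ℝ (Fin 4) | y 0 < 0} ∧ tsupport g ⊆ {y : EuclideanSpace ℝ (Fin 4) | 0 < y 0} ∧ tsupport h ⊆ {y : EuclideanSpace ℝ (Fin 4) | 0 < y 0} ∧ Disjoint (tsupport g) (tsupport h) ∧ 0 < δ ∧ ∀ᶠ k in atTop, δ ≤ |latticeSchwinger r.ρ sch (fun s => s.F) k 3 (fun _ => r.curvature) ![f, g, h] - latticeSchwinger r.ρ sch (fun s => s.F) k 1 (fun _ => r.curvature) ![f] * latticeSchwinger r.ρ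 sch (fun s => s.F) k 2 (fun _ => r.curvature) ![g, h] - latticeSchwinger r.ρ sch (fun s => s.F) k 1 (fun _ => r.curvature) ![g] * latticeSchwinger r.ρ sch (fun s => s.F) k 2 (fun _ => r.curvature) ![f, h] - latticeSchwinger r.ρ sch (fun s => s.F) k 1 (fun _ => r.curvature) ![h] * latticeSchwinger r.ρ sch (fun s => s.F) k 2 (fun _ => r.curvature) ![f, g] + 2 * (latticeSchwinger r.ρ sch (fun s => s.F) k 1 (fun _ => r.curvature) ![f] * latticeSchwinger r.ρ sch (fun s => s.F) k 1 (fun _ => r.curvature) ![g] * latticeSchwinger r.ρ sch (fun s => s.F) k 1 (fun _ => r.curvature) ![h])|)) → Summit.QuantumFields.YangMills.Theses.PencilRigidity.WeakCouplingHypercubicLimit := by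
  intro hcore
  refine weakCouplingHypercubicLimit_of_ufbCore fun G _ _ _ _ _ _ hG => ?_
  obtain ⟨r, sch, hw, hpv, hpr, hUFB, ⟨Δ, C, hΔ, hRP⟩, hNG⟩ := hcore G hG
  exact ⟨r, sch, hw, hpv, hpr, hUFB, ⟨Δ / 2, 2 * max C 0, half_pos hΔ,
    stub_gapOfRPSpectral G r sch Δ C hΔ (Filter.tendsto_atTop.1 hw 0) hRP,
    stub_rpSpectralAnti G r sch Δ (Δ / 2) C (by linarith) (by linarith) hRP⟩, hNG⟩

/-- **The twin crux `CoincidenceRotationBootstrap.HypercubicLimit` (stmt-16154) BY NAME from the RP core** (`stub_siblingTie`). [folklore] -/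
theorem hypercubicLimit_of_rpCore : (∀ (G : Type) [Group G] [TopologicalSpace G] [IsTopologicalGroup G] [CompactSpace G] [MeasurableSpace G] [BorelSpace G], IsCompactSimpleLieGroup G → ∃ (r : LatticeRep G) (sch : SpeciesScheme (YMSpecies G)), sch.HasWeakCouplingLimit ∧ PolyVolume sch ∧ PolyRenorm r sch ∧ UniformFunctionalBoundPlanes r sch ∧ (∃ Δ C : ℝ, 0 < Δ ∧ RPSpectral r sch Δ C) ∧ (∃ (f g h : 𝓢(EuclideanSpace ℝ (Fin 4), ℝ)) (δ : ℝ), tsupport f ⊆ {y : EuclideanSpace ℝ (Fin 4) | y 0 < 0} ∧ tsupport g ⊆ {y : EuclideanSpace ℝ (Fin 4) | 0 < y 0} ∧ tsupport h ⊆ {y : EuclideanSpace ℝ (Fin 4) | 0 < y 0} ∧ Disjoint (tsupport g) (tsupport h) ∧ 0 < δ ∧ ∀ᶠ k in atTop, δ ≤ |latticeSchwinger r.ρ sch (fun s => s.F) k 3 (fun _ => r.curvature) ![f, g, h] - latticeSchwinger r.ρ sch (fun s => s.F) k 1 (fun _ => r.curvature) ![f] * latticeSchwinger r.ρ sch (fun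 s => s.F) k 2 (fun _ => r.curvature) ![g, h] - latticeSchwinger r.ρ sch (fun s => s.F) k 1 (fun _ => r.curvature) ![g] * latticeSchwinger r.ρ sch (fun s => s.F) k 2 (fun _ => r.curvature) ![f, h] - latticeSchwinger r.ρ sch (fun s => s.F) k 1 (fun _ => r.curvature) ![h] * latticeSchwinger r.ρ sch (fun s => s.F) k 2 (fun _ => r.curvature) ![f, g] + 2 * (latticeSchwinger r.ρ sch (fun s => s.F) k 1 (fun _ => r.curvature) ![f] * latticeSchwinger r.ρ sch (fun s => s.F) k 1 (fun _ => r.curvature) ![g] * latticeSchwinger r.ρ sch (fun s => s.F) k 1 (fun _ => r.curvature) ![h])|)) → Summit.QuantumFields.YangMills.Theses.CoincidenceRotationBootstrap.HypercubicLimit :=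
  fun hcore => SiblingTie.stub_siblingTie.1 (weakCouplingHypercubicLimit_of_rpCore hcore)

end Summit.QuantumFields.YangMills.Theorems.WeakCouplingHypercubicLimit.TraceNormColdPressure

end
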